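import Literature.Probability.Percolation.InterfaceScalingLimitProofs
import Literature.Probability.Percolation.OpenPathAnnulusCrossing
import Literature.Probability.RandomPlanarGeometry.SelfAvoidingWalk

/-!
# S1 of the line `socket-comparison` (crux `ShellCrossingBound`, stmt-CriticalPhenomena-4728):
# `TravCountBound` — coarse meshes are free (PROVED)

Candidate proof of the stub `stub_travCount` of
`Cruxes/ShellCrossingBound/Lines/socket-comparison.lean`, verbatim statement (lead's v2 text):
for `ρ, δ₁ > 0` there is `N` such that NO self-avoiding lattice polyline of mesh `δ ≥ δ₁` (any domain,
any endpoints, any centre `x`, any outer radius `R > ρ`) makes `N` separate traversals of `D(x; ρ, R)`.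

Proof (the tree's Aizenman–Burchard short-distance cutoff machinery of
`Percolation/InterfaceScalingLimitProofs.lean`): the times the dyadic polyline spends in the convex
ball `B̄(x, ρ)` are covered by `#(segments meeting the ball) + 1` order-connected pieces
(`hasOrdConnectedCover_preimage_polylineFrom`); the segments are distinct lattice edges (the walk is a
path) whose ends lie in the box of half-width `n = ⌈ρ/δ₁⌉ + 2` about `nearestSite δ x`
(`dist_meshPoint_le_of_mem_segment`, `abs_sub_nearestSite_le`), so at most `((2n+1)²)²` of them meet
the ball (`segMeetCount_map_le_card`); and `k` separate traversals need `k ≤ 2·(pieces)`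
(`le_of_hasTraversals_of_hasOrdConnectedCover`). Hence `N = 2 (((2n+1)²)² + 1) + 1` works.

Written by the drefute seat (refuter-drefute-stmt-CriticalPhenomena-4728-0) as item evidence for the
lead / the S1 worker; positive statement, NOT landed by the refuter.
-/

noncomputable section

open Set Metric
open Literature.Probability.RandomPlanarGeometry Literature.Probability.LatticeModels
open Literature.Probability.Percolation

namespace Summit.CriticalPhenomena.SAWScalingLimit.Cruxes.ShellCrossingBound.SocketComparison.Drefute

/-- The box of sites of half-width `n` about `c`. -/
def siteBox (c : Site 2) (n : ℕ) : Finset (Site 2) :=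
  (Finset.Icc (c 0 - n) (c 0 + n) ×ˢ Finset.Icc (c 1 - n) (c 1 + n)).image fun q => ![q.1, q.2]

/-- The box has at most `(2n+1)²` sites. -/
theorem card_siteBox_le (c : Site 2) (n : ℕ) : (siteBox c n).card ≤ (2 * n + 1) ^ 2 := by
  refine Finset.card_image_le.trans ?_
  have h0 : (c 0 + n + 1 - (c 0 - n)).toNat = 2 * n + 1 := by omega
  have h1 : (c 1 + n + 1 - (c 1 - n)).toNat = 2 * n + 1 := by omega
  rw [Finset.card_product, Int.card_Icc, Int.card_Icc, h0, h1]
  exact le_of_eq (by ring)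

/-- Sites coordinatewise within `n` of `c` belong to the box. -/
theorem mem_siteBox {c : Site 2} {n : ℕ} {v : Site 2} (h : ∀ i, |v i - c i| ≤ n) :
    v ∈ siteBox c n := by
  rw [siteBox, Finset.mem_image]
  refine ⟨(v 0, v 1), ?_, ?_⟩
  · have h0 := abs_le.1 (h 0)
    have h1 := abs_le.1 (h 1)
    simp only [Finset.mem_product, Finset.mem_Icc]
    refine ⟨⟨?_, ?_⟩, ?_, ?_⟩ <;> omega
  · ext j; fin_cases j <;> rfl

/-- **S1 `TravCountBound` (verbatim stub statement), proved.** -/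
theorem travCountBound :
    ∀ (ρ δ₁ : ℝ), 0 < ρ → 0 < δ₁ → ∃ N : ℕ, ∀ (Ω : Set ℂ) (δ : ℝ) (u v : Site 2)
      (γ : SAW.DomainSAW Ω δ u v) (x : ℂ) (R : ℝ), δ₁ ≤ δ → ρ < R →
        ¬ (⟨γ.walk.toCurve (meshPoint δ)⟩ : Curve ℂ).HasTraversals N x ρ R := by
  classical
  intro ρ δ₁ hρ hδ₁
  set n : ℕ := ⌈ρ / δ₁⌉₊ + 2 with hn
  set M : ℕ := ((2 * n + 1) ^ 2) ^ 2 with hM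
  refine ⟨2 * (M + 1) + 1, ?_⟩
  intro Ω δ u v γ x R hδ hρR htr
  have hδ0 : 0 < δ := hδ₁.trans_le hδ
  set l : List (Site 2) := γ.walk.support.tail with hl
  have hsupp : γ.walk.support = u :: l := (γ.walk.cons_tail_support).symm
  -- the curve is the polyline from `meshPoint δ u` through `l`
  have hcurve : (⟨γ.walk.toCurve (meshPoint δ)⟩ : Curve ℂ) =
      ⟨polyline ((u :: l).map (meshPoint δ))⟩ := by
    rw [SimpleGraph.Walk.toCurve, hsupp]
  rw [hcurve] at htr
  have hfun : ∀ t, (⟨polyline ((u :: l).map (meshPoint δ))⟩ : Curve ℂ) t =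
      (polylineFrom (meshPoint δ u) (l.map (meshPoint δ))).2 t := fun t => rfl
  have hcov := hasOrdConnectedCover_preimage_polylineFrom (convex_closedBall x ρ)
    (meshPoint δ u) (l.map (meshPoint δ))
  have hpre : (⟨polyline ((u :: l).map (meshPoint δ))⟩ : Curve ℂ) ⁻¹' closedBall x ρ =
      (polylineFrom (meshPoint δ u) (l.map (meshPoint δ))).2 ⁻¹' closedBall x ρ := by
    ext t
    rw [mem_preimage, mem_preimage, hfun]
  rw [← hpre] at hcov
  -- consecutive pairs of the support: pairwise distinct, and lattice neighbours
  have hnd : ((u :: l).zip l).Nodup := by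
    have hsn : (u :: l).Nodup := hsupp ▸ γ.isPath.support_nodup
    have hl' : l.Nodup := hsn.of_cons
    have hmap : ((u :: l).zip l).map Prod.snd = l := List.map_snd_zip (l₁ := u :: l) (l₂ := l) (by simp)
    rw [← hmap] at hl'
    exact hl'.of_map _
  have hadj : ∀ pq ∈ (u :: l).zip l, (zdGraph 2).Adj pq.1 pq.2 := by
    intro pq hpq
    have hchain : List.IsChain (discreteDomainGraph Ω δ).Adj (u :: l) :=
      hsupp ▸ γ.walk.isChain_adj_support
    have hinf : [pq.1, pq.2] <:+: (u :: l) := infix_of_mem_zip_tail (u :: l) hpq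
    have hadj' : (discreteDomainGraph Ω δ).Adj pq.1 pq.2 := List.isChain_pair.1 (hchain.infix hinf)
    exact meshGraph_le_zdGraph Ω δ (discreteDomainGraph_le_meshGraph Ω δ hadj')
  -- every segment meeting the small ball has both ends in the box about `nearestSite δ x`
  have hK : ρ / δ₁ + 1 + 1 ≤ (n : ℝ) := by
    have : ρ / δ₁ ≤ (⌈ρ / δ₁⌉₊ : ℝ) := Nat.le_ceil _
    rw [hn]
    push_cast
    linarith
  have hρδ : ρ ≤ ρ / δ₁ * δ := by
    rw [div_mul_eq_mul_div, le_div_iff₀ hδ₁]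
    exact mul_le_mul_of_nonneg_left hδ hρ.le
  have hnear : ∀ (w : Site 2) (z : ℂ), dist (meshPoint δ w) z ≤ δ → z ∈ closedBall x ρ →
      w ∈ siteBox (nearestSite δ x) n := by
    intro w z hwz hz
    rw [mem_closedBall] at hz
    have hdist : dist (meshPoint δ w) x ≤ (ρ / δ₁ + 1) * δ := by
      have := dist_triangle (meshPoint δ w) z x
      linarith
    exact mem_siteBox fun i => abs_sub_nearestSite_le hδ0 hdist hK i
  have hS : ∀ pq ∈ (u :: l).zip l,
      (segment ℝ (meshPoint δ pq.1) (meshPoint δ pq.2) ∩ closedBall x ρ).Nonempty →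
        pq ∈ siteBox (nearestSite δ x) n ×ˢ siteBox (nearestSite δ x) n := by
    intro pq hpq hmeet
    obtain ⟨z, hzseg, hz⟩ := hmeet
    have h1 : dist (meshPoint δ pq.1) z ≤ δ :=
      dist_meshPoint_le_of_mem_segment hδ0 (hadj pq hpq) hzseg
    have hzseg' : z ∈ segment ℝ (meshPoint δ pq.2) (meshPoint δ pq.1) := by
      rw [segment_symm]; exact hzseg
    have h2 : dist (meshPoint δ pq.2) z ≤ δ :=
      dist_meshPoint_le_of_mem_segment hδ0 (hadj pq hpq).symm hzseg'
    exact Finset.mem_product.2 ⟨hnear _ z h1 hz, hnear _ z h2 hz⟩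
  have hcount : segMeetCount (closedBall x ρ) (meshPoint δ u) (l.map (meshPoint δ)) ≤
      (siteBox (nearestSite δ x) n ×ˢ siteBox (nearestSite δ x) n).card :=
    segMeetCount_map_le_card (closedBall x ρ) (meshPoint δ) u l _ hnd hS
  have hcard : (siteBox (nearestSite δ x) n ×ˢ siteBox (nearestSite δ x) n).card ≤ M := by
    rw [Finset.card_product, hM, sq ((2 * n + 1) ^ 2)]
    exact Nat.mul_le_mul (card_siteBox_le _ n) (card_siteBox_le _ n)
  have hle := le_of_hasTraversals_of_hasOrdConnectedCover hρR
    (hcov.mono (Nat.add_le_add_right (hcount.trans hcard) 1)) htr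
  omega

end Summit.CriticalPhenomena.SAWScalingLimit.Cruxes.ShellCrossingBound.SocketComparison.Drefute

end
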